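import Mathlib.RingTheory.Polynomial.Cyclotomic.Expand
import Mathlib.RingTheory.Polynomial.Cyclotomic.Eval
import Mathlib.FieldTheory.Finite.Basic
import Mathlib.NumberTheory.Multiplicity
import Mathlib.Tactic
import HarnessLib

/-!
# Zsigmondy's theorem (Bang 1886 / Zsigmondy 1892), following Roitman's proof

M. Roitman, *On Zsigmondy primes*, Proc. AMS 125 (1997) 1913–1919 [Roitman1997], verbatim:
*"if `a, n` are integers greater than 1, then a prime `p` is called a Zsigmondy prime for `⟨a, n⟩` if
`p ∤ a` and the order of `a (mod p)` equals `n`."* **Lemma 1.** *"Let `a > 1` and `n = q^i r` be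
integers, where `q` is a prime, `i ≥ 1` and `r` is a positive integer not divisible by `q`. Let
`b = a^{q^{i−1}}`. Then `Φ_n(a) > (b^{q−2}(b − 1))^{φ(r)}`."* (proof: `Φ_n(a) = Φ_r(b^q)/Φ_r(b)`).
**Proposition 2.** *"Let `a > 1` and `n > 1` be integers. Let `q` be a prime factor of `Φ_n(a)`. Then
`q` is a non Zsigmondy prime for `⟨a, n⟩` iff `q` divides `n`. In this case `q` is the largest prime
factor of `n`, and `n = q^i r`, where `r` is a positive integer dividing `q − 1`; moreover, `q²` does
not divide `Φ_n(a)` unless `q = n = 2`. Thus, if there are no Zsigmondy primes for `⟨a, n⟩`, then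
`Φ_n(a)` is a power of `q`; if also `n > 2` then `Φ_n(a) = q`."* **Theorem 3 (Zsigmondy's Theorem).**
*"Let `a` and `n` be integers greater than 1. There exists a prime divisor `q` of `a^n − 1` such that
`q` does not divide `a^j − 1` for all `j`, `0 < j < n`, except exactly in the following cases:
(1) `n = 2`, `a = 2^s − 1`, where `s ≥ 2`. (2) `n = 6`, `a = 2`."*

Everything is PROVED, following the printed architecture: `cyclEval n a = Φ_n(a) ∈ ℕ`;
Lemma 1 in the form actually used (`b^{q−2}(b−1) < Φ_n(a)`, via `Φ_n(a)·Φ_r(b) = Φ_r(b^q)` and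
Mathlib's bounds `(x−1)^{φ(r)} < Φ_r(x) < (x+1)^{φ(r)}`); the parts of Proposition 2 used in Theorem 3
(`orderOf_eq_ordCompl_of_prime_dvd_cyclEval`, `prime_dvd_cyclEval_unique`,
`sq_not_dvd_cyclEval`); and Theorem 3 (`zsigmondy`, with the order form `exists_prime_orderOf_eq`
and the two exceptional cases checked in `no_zsigmondy_prime_two_six`, `no_zsigmondy_prime_mersenne`).
Originals: A. S. Bang, Taltheoretiske Undersøgelser, Tidsskrift for Math. (5) 4 (1886) (`b = 1`);
K. Zsigmondy, Zur Theorie der Potenzreste, Monatsh. Math. 3 (1892) 265–284 [Zsigmondy1892].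
Only the case `b = 1` of Zsigmondy's `a^n − b^n` theorem is formalized (as in [Roitman1997]).
-- TODO(general form): `a^n − b^n` with `gcd(a, b) = 1`.
-/

namespace Literature.NumberTheory.Congruences.Zsigmondy

open Polynomial Finset

/-- `Φ_n(a)` as a natural number (`a ∈ ℕ`; it is positive for `a ≥ 2`).
[cite: Roitman1997, §1 (notation Φ_n(a))] -/
noncomputable def cyclEval (n a : ℕ) : ℕ := ((cyclotomic n ℤ).eval (a : ℤ)).natAbs

/-- `(Φ_n(a) : ℤ)` is the integer evaluation, for `a ≥ 1`. [folklore] -/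
private theorem coe_cyclEval {n a : ℕ} (ha : 1 ≤ a) :
    (cyclEval n a : ℤ) = (cyclotomic n ℤ).eval (a : ℤ) :=
  Int.natAbs_of_nonneg ((cyclotomic_pos_and_nonneg n (a : ℤ)).2 (by exact_mod_cast ha))

/-- `Φ_n(a) > 0` for `a ≥ 2`. [cite: Roitman1997, §1 ("Φ_n(a) > 1")] -/
theorem cyclEval_pos {n a : ℕ} (ha : 2 ≤ a) : 0 < cyclEval n a :=
  Int.natAbs_pos.2 ((cyclotomic_pos_and_nonneg n (a : ℤ)).1 (by exact_mod_cast ha)).ne'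

/-- `(a − 1)^{φ(n)} < Φ_n(a)` (`n ≥ 2`, `a ≠ 1`); in particular `Φ_n(a) ≥ 2` for `a ≥ 2`.
[cite: Roitman1997, §1 ("Φ_n(a) = ∏|a − ε_i| > (a−1)^{φ(n)} ≥ 1")] -/
theorem two_le_cyclEval {n a : ℕ} (hn : 2 ≤ n) (ha : 2 ≤ a) : 2 ≤ cyclEval n a := by
  have h := sub_one_pow_totient_lt_natAbs_cyclotomic_eval (n := n) (q := a) hn (by omega)
  have h1 : 1 ≤ (a - 1) ^ n.totient := Nat.one_le_pow _ _ (by omega)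
  unfold cyclEval; omega

/-- `Φ_n(a) ∣ aⁿ − 1`. [cite: Roitman1997, §1 ("aⁿ − 1 = ∏_{d ∣ n} Φ_d(a)")] -/
theorem cyclEval_dvd_pow_sub_one {n a : ℕ} (ha : 1 ≤ a) : cyclEval n a ∣ a ^ n - 1 := by
  obtain ⟨Q, hQ⟩ := cyclotomic.dvd_X_pow_sub_one n ℤ
  have h := congr_arg (eval (a : ℤ)) hQ
  simp only [eval_sub, eval_pow, eval_X, eval_one, eval_mul] at h
  have hdvd : ((cyclotomic n ℤ).eval (a : ℤ)) ∣ ((a ^ n - 1 : ℕ) : ℤ) := by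
    rw [Nat.cast_sub (Nat.one_le_pow _ _ ha)]; push_cast; exact ⟨_, h⟩
  rw [← coe_cyclEval ha] at hdvd
  exact_mod_cast hdvd

/-- For a proper divisor `d` of `n`: `(a^d − 1)·Φ_n(a) ∣ aⁿ − 1`.
[cite: Roitman1997, proof of Prop. 2 ("Φ_n(X) divides (Xⁿ − 1)/(X^{n/p} − 1)")] -/
theorem pow_sub_one_mul_cyclEval_dvd {n a d : ℕ} (ha : 1 ≤ a) (hd : d ∈ n.properDivisors) :
    (a ^ d - 1) * cyclEval n a ∣ a ^ n - 1 := by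
  obtain ⟨Q, hQ⟩ := X_pow_sub_one_mul_cyclotomic_dvd_X_pow_sub_one_of_dvd ℤ hd
  have h := congr_arg (eval (a : ℤ)) hQ
  simp only [eval_sub, eval_pow, eval_X, eval_one, eval_mul] at h
  have hdvd : ((a : ℤ) ^ d - 1) * ((cyclotomic n ℤ).eval (a : ℤ)) ∣ ((a ^ n - 1 : ℕ) : ℤ) := by
    rw [Nat.cast_sub (Nat.one_le_pow _ _ ha)]; push_cast; exact ⟨_, h⟩
  rw [← coe_cyclEval ha, show ((a : ℤ) ^ d - 1) = ((a ^ d - 1 : ℕ) : ℤ) by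
    rw [Nat.cast_sub (Nat.one_le_pow _ _ ha)]; push_cast; ring] at hdvd
  exact_mod_cast hdvd

/-- `p ∣ a^j − 1 ↔ (a : ZMod p)^j = 1` (`a ≥ 1`). [folklore] -/
private theorem dvd_pow_sub_one_iff {p a j : ℕ} (ha : 1 ≤ a) :
    p ∣ a ^ j - 1 ↔ (a : ZMod p) ^ j = 1 := by
  rw [← ZMod.natCast_eq_zero_iff, Nat.cast_sub (Nat.one_le_pow _ _ ha)]
  push_cast
  exact sub_eq_zero

/-- A prime factor `p` of `Φ_n(a)`, `n = p^k m` with `p ∤ m` (`k = 0` allowed): the order of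
`a (mod p)` is exactly `m`. (Here is where `Φ_{p^k m} = Φ_m^{φ(p^k)}` over `𝔽_p` and "roots of `Φ_m`
over `𝔽_p` = elements of order `m`" enter.) [cite: Roitman1997, Prop. 2 (proof: "the order of a (mod q) is of the form n/q^i")] -/
theorem orderOf_eq_of_prime_dvd_cyclEval {p k m a : ℕ} [hp : Fact p.Prime] (hm : ¬ p ∣ m)
    (ha : 1 ≤ a) (hd : p ∣ cyclEval (p ^ k * m) a) : orderOf (a : ZMod p) = m := by
  have hroot : (cyclotomic (p ^ k * m) (ZMod p)).IsRoot (a : ZMod p) := by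
    rw [IsRoot.def, ← map_cyclotomic_int, Polynomial.eval_natCast_map, eq_intCast,
      ZMod.intCast_zmod_eq_zero_iff_dvd, ← coe_cyclEval ha]
    exact_mod_cast hd
  haveI : NeZero (m : ZMod p) :=
    ⟨fun h => hm ((ZMod.natCast_eq_zero_iff m p).1 h)⟩
  exact ((isRoot_cyclotomic_prime_pow_mul_iff_of_charP.1 hroot).eq_orderOf).symm

/-- If `p ∣ Φ_n(a)` (`n ≥ 1`, `a ≥ 1`) then `p ∤ a`, i.e. `(a : ZMod p) ≠ 0` (for `p > 1`).
[cite: Roitman1997, §1 (definition of Zsigmondy prime: "p ∤ a")] -/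
theorem cast_ne_zero_of_dvd_cyclEval {p n a : ℕ} (hp : 1 < p) (hn : 1 ≤ n) (ha : 1 ≤ a)
    (hd : p ∣ cyclEval n a) : (a : ZMod p) ≠ 0 := by
  intro h0
  have h1 : (a : ZMod p) ^ n = 1 := (dvd_pow_sub_one_iff ha).1 (hd.trans (cyclEval_dvd_pow_sub_one ha))
  rw [h0, zero_pow (by omega)] at h1
  haveI : Fact (1 < p) := ⟨hp⟩
  exact zero_ne_one h1

/-! ## Lemma 1 (Roitman): a lower bound for `Φ_n(a)` through `Φ_n(a) = Φ_r(b^q)/Φ_r(b)` -/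

/-- Upper bound in `ℕ`: `Φ_r(x) < (x + 1)^{φ(r)}` for `r ≥ 3`, `x ≥ 2` (Mathlib's real bound, cast).
[cite: Roitman1997, proof of Lemma 1 ("∏(b − ε_i) < (b+1)^{φ(r)}")] -/
theorem cyclEval_lt_add_one_pow_totient {r x : ℕ} (hr : 3 ≤ r) (hx : 2 ≤ x) :
    cyclEval r x < (x + 1) ^ r.totient := by
  have h := cyclotomic_eval_lt_add_one_pow_totient (n := r) (q := (x : ℝ)) hr (by exact_mod_cast hx)
  have hcast : ((cyclEval r x : ℤ) : ℝ) = eval (x : ℝ) (cyclotomic r ℝ) := by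
    rw [coe_cyclEval (by omega)]
    have := cyclotomic.eval_apply (x : ℤ) r (algebraMap ℤ ℝ)
    simp only [algebraMap_int_eq, eq_intCast, Int.cast_natCast] at this
    exact this.symm
  have h' : ((cyclEval r x : ℕ) : ℝ) < (((x + 1) ^ r.totient : ℕ) : ℝ) := by
    have e : ((cyclEval r x : ℕ) : ℝ) = ((cyclEval r x : ℤ) : ℝ) := by norm_cast
    rw [e, hcast]; push_cast; exact h
  exact_mod_cast h'

/-- Lower bound in `ℕ`: `(x − 1)^{φ(r)} < Φ_r(x)` for `r ≥ 2`, `x ≠ 1` (Mathlib).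
[cite: Roitman1997, §1 / proof of Lemma 1 ("∏(b^q − ε_i) > (b^q − 1)^{φ(r)}")] -/
theorem sub_one_pow_totient_lt_cyclEval {r x : ℕ} (hr : 2 ≤ r) (hx : x ≠ 1) :
    (x - 1) ^ r.totient < cyclEval r x :=
  sub_one_pow_totient_lt_natAbs_cyclotomic_eval hr hx

/-- `Φ_{q^{j+1} r}(a) = Φ_{qr}(a^{q^j})` (`q` prime; iterated `Φ_{mq}(X) = Φ_m(X^q)` for `q ∣ m`).
[cite: Roitman1997, proof of Lemma 1 ("Φ_n(a) = Φ_r(a^{q^i})/Φ_r(a^{q^{i−1}})")] -/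
theorem cyclEval_prime_pow_mul {q r : ℕ} (hq : q.Prime) (j a : ℕ) :
    cyclEval (q ^ (j + 1) * r) a = cyclEval (q * r) (a ^ q ^ j) := by
  induction j generalizing a with
  | zero => simp
  | succ j ih =>
    have hexp := cyclotomic_expand_eq_cyclotomic hq
      (dvd_mul_of_dvd_left (dvd_pow_self q (Nat.succ_ne_zero j)) r) ℤ
    have h2 : cyclEval (q ^ (j + 2) * r) a = cyclEval (q ^ (j + 1) * r) (a ^ q) := by
      unfold cyclEval
      rw [show q ^ (j + 2) * r = q ^ (j + 1) * r * q by ring, ← hexp, expand_eval]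
      push_cast; rfl
    rw [h2, ih (a ^ q), ← pow_mul, pow_succ']

/-- `Φ_{qr}(b)·Φ_r(b) = Φ_r(b^q)` for a prime `q ∤ r`.
[cite: Roitman1997, proof of Lemma 1 ("Φ_n(a) = Φ_r(b^q)/Φ_r(b)")] -/
theorem cyclEval_prime_mul_mul_cyclEval {q r : ℕ} (hq : q.Prime) (hqr : ¬ q ∣ r) (b : ℕ) :
    cyclEval (q * r) b * cyclEval r b = cyclEval r (b ^ q) := by
  have hexp := cyclotomic_expand_eq_cyclotomic_mul hq hqr ℤ
  have h := congr_arg (eval (b : ℤ)) hexp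
  rw [expand_eval, eval_mul, mul_comm r q] at h
  unfold cyclEval
  rw [← Int.natAbs_mul, ← h]; push_cast; rfl

/-- `Φ₁(x) = x − 1`. [folklore] -/
private theorem cyclEval_one {x : ℕ} (hx : 1 ≤ x) : cyclEval 1 x = x - 1 := by
  unfold cyclEval
  rw [cyclotomic_one, eval_sub, eval_X, eval_one, ← Nat.cast_one, ← Nat.cast_sub hx, Int.natAbs_natCast]

/-- `Φ₂(x) = x + 1`. [folklore] -/
private theorem cyclEval_two (x : ℕ) : cyclEval 2 x = x + 1 := by
  unfold cyclEval
  rw [cyclotomic_two, eval_add, eval_X, eval_one, ← Nat.cast_one, ← Nat.cast_add, Int.natAbs_natCast]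

/-- **Lemma 1** [Roitman1997] in the form used below: for `a ≥ 2`, `n = q^i r` with `q` prime,
`i ≥ 1`, `q ∤ r`, `r ≥ 1`, and `b = a^{q^{i−1}}`: `b^{q−2}(b − 1) < Φ_n(a)`. (Printed:
`Φ_n(a) > (b^{q−2}(b−1))^{φ(r)}`; we prove the consequence with exponent `1`, by the printed route
`Φ_n(a)Φ_r(b) = Φ_r(b^q)`, `(b^q − 1)^{φ(r)} < Φ_r(b^q)`, `Φ_r(b) < (b+1)^{φ(r)}` for `r ≥ 3`, and the
explicit values `Φ_1 = X − 1`, `Φ_2 = X + 1`.) [cite: Roitman1997, Lemma 1] -/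
theorem roitman_lemma1 {a q i r : ℕ} (ha : 2 ≤ a) (hq : q.Prime) (hi : 1 ≤ i) (hr : 0 < r)
    (hqr : ¬ q ∣ r) :
    (a ^ q ^ (i - 1)) ^ (q - 2) * (a ^ q ^ (i - 1) - 1) < cyclEval (q ^ i * r) a := by
  obtain ⟨j, rfl⟩ : ∃ j, i = j + 1 := ⟨i - 1, by omega⟩
  simp only [Nat.add_sub_cancel]
  rw [cyclEval_prime_pow_mul hq j a]
  set b : ℕ := a ^ q ^ j with hb
  have hb2 : 2 ≤ b := by
    rw [hb]; calc (2 : ℕ) ≤ a := ha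
      _ ≤ a ^ q ^ j := Nat.le_self_pow (pow_ne_zero _ hq.ne_zero) a
  have hq2 : 2 ≤ q := hq.two_le
  have hmul := cyclEval_prime_mul_mul_cyclEval hq hqr b
  set X := cyclEval (q * r) b with hX
  -- `u = b^(q-2)`, so that `b^q = u * b^2`
  set u := b ^ (q - 2) with hu
  have hu1 : 1 ≤ u := Nat.one_le_pow _ _ (by omega)
  have hbq : b ^ q = u * b ^ 2 := by rw [hu, ← pow_add, Nat.sub_add_cancel hq2]
  by_contra hle
  rw [not_lt] at hle
  -- `X ≤ u * (b - 1)`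
  rcases Nat.lt_or_ge r 3 with hr3 | hr3
  · interval_cases r
    · -- r = 1 : Φ₁ = X - 1, so X (b - 1) = b^q - 1
      have hb1 : 1 ≤ b := by omega
      rw [cyclEval_one hb1, cyclEval_one (Nat.one_le_pow q b hb1), hbq] at hmul
      have h3 : X * (b - 1) ≤ u * (b - 1) * (b - 1) := Nat.mul_le_mul_right _ hle
      have hub : 1 ≤ u * b ^ 2 := Nat.one_le_iff_ne_zero.2 (by positivity)
      zify [hb1, hub] at h3 hmul
      nlinarith
    · -- r = 2 : Φ₂ = X + 1, so X (b + 1) = b^q + 1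
      have hb1 : 1 ≤ b := by omega
      rw [cyclEval_two, cyclEval_two, hbq] at hmul
      have h3 : X * (b + 1) ≤ u * (b - 1) * (b + 1) := Nat.mul_le_mul_right _ hle
      zify [hb1] at h3 hmul
      nlinarith
  · -- r ≥ 3 : use both bounds
    have hlow := sub_one_pow_totient_lt_cyclEval (r := r) (x := b ^ q) (by omega)
      (by
        have : 2 ≤ b ^ q := le_trans hb2 (Nat.le_self_pow hq.ne_zero b)
        omega)
    have hup := cyclEval_lt_add_one_pow_totient hr3 hb2
    have hφ : r.totient ≠ 0 := (Nat.totient_pos.2 hr).ne'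
    -- Φ_r(b^q) = X Φ_r(b) ≤ u(b-1) Φ_r(b) < u(b-1)(b+1)^φ ≤ (u(b-1)(b+1))^φ ≤ (b^q - 1)^φ < Φ_r(b^q)
    have hw : 0 < u * (b - 1) := Nat.mul_pos (by omega) (by omega)
    have h1 : cyclEval r (b ^ q) < u * (b - 1) * (b + 1) ^ r.totient := by
      rw [← hmul]
      calc X * cyclEval r b ≤ u * (b - 1) * cyclEval r b := Nat.mul_le_mul_right _ hle
        _ < u * (b - 1) * (b + 1) ^ r.totient := Nat.mul_lt_mul_of_pos_left hup hw
    have h2 : u * (b - 1) * (b + 1) ^ r.totient ≤ (b ^ q - 1) ^ r.totient := by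
      calc u * (b - 1) * (b + 1) ^ r.totient
          ≤ (u * (b - 1)) ^ r.totient * (b + 1) ^ r.totient :=
            Nat.mul_le_mul_right _ (Nat.le_self_pow hφ _)
        _ = (u * (b - 1) * (b + 1)) ^ r.totient := (mul_pow _ _ _).symm
        _ ≤ (b ^ q - 1) ^ r.totient := Nat.pow_le_pow_left ?_ _
      rw [hbq]
      have hb1 : 1 ≤ b := by omega
      have hub : 1 ≤ u * b ^ 2 := Nat.one_le_iff_ne_zero.2 (by positivity)
      zify [hb1, hub]
      nlinarith
    omega

/-! ## Proposition 2 (the parts used in Theorem 3) -/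

/-- A prime factor `p` of `Φ_n(a)` which is not a Zsigmondy prime (order of `a (mod p)` is not `n`)
divides `n`, and `r = n / p^{v_p(n)}` (the order of `a (mod p)`) divides `p − 1`.
[cite: Roitman1997, Prop. 2 ("q is a non Zsigmondy prime iff q divides n … r divides q − 1")] -/
theorem dvd_of_prime_dvd_cyclEval {p n a : ℕ} (hp : p.Prime) (hn : 2 ≤ n) (ha : 2 ≤ a)
    (hd : p ∣ cyclEval n a) (hno : orderOf (a : ZMod p) ≠ n) :
    p ∣ n ∧ orderOf (a : ZMod p) = n / p ^ n.factorization p ∧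
      n / p ^ n.factorization p ∣ p - 1 := by
  haveI := Fact.mk hp
  have hnm : n = p ^ n.factorization p * (n / p ^ n.factorization p) :=
    (Nat.ordProj_mul_ordCompl_eq_self n p).symm
  have hm : ¬ p ∣ n / p ^ n.factorization p := Nat.not_dvd_ordCompl hp (by omega)
  have hord : orderOf (a : ZMod p) = n / p ^ n.factorization p :=
    orderOf_eq_of_prime_dvd_cyclEval hm (by omega) (hnm ▸ hd)
  have ha0 : (a : ZMod p) ≠ 0 := cast_ne_zero_of_dvd_cyclEval hp.one_lt (by omega) (by omega) hd
  refine ⟨?_, hord, hord ▸ ZMod.orderOf_dvd_card_sub_one ha0⟩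
  by_contra hpn
  rw [Nat.factorization_eq_zero_of_not_dvd hpn, pow_zero, Nat.div_one] at hord
  exact hno hord

/-- In the situation of `dvd_of_prime_dvd_cyclEval`, two prime factors of `Φ_n(a)` coincide
("`q` is the largest prime factor of `n`"). [cite: Roitman1997, Prop. 2 ("Thus q is the largest prime factor of n" / "Φ_n(a) is a power of q")] -/
theorem prime_dvd_cyclEval_unique {p q n a : ℕ} (hp : p.Prime) (hq : q.Prime) (hn : 2 ≤ n)
    (ha : 2 ≤ a) (hpd : p ∣ cyclEval n a) (hqd : q ∣ cyclEval n a)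
    (hpo : orderOf (a : ZMod p) ≠ n) (hqo : orderOf (a : ZMod q) ≠ n) : p = q := by
  by_contra hne
  obtain ⟨hpn, -, hpr⟩ := dvd_of_prime_dvd_cyclEval hp hn ha hpd hpo
  obtain ⟨hqn, -, hqr⟩ := dvd_of_prime_dvd_cyclEval hq hn ha hqd hqo
  -- `q ∣ n = p^k r_p` with `q ≠ p` gives `q ∣ r_p ∣ p - 1`, so `q < p`; symmetrically `p < q`.
  have h1 : q ≤ p - 1 := by
    have hnm := (Nat.ordProj_mul_ordCompl_eq_self n p).symm
    have hq' : q ∣ n / p ^ n.factorization p :=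
      (Nat.Coprime.pow_right _ ((Nat.coprime_primes hq hp).2 (Ne.symm hne))).dvd_of_dvd_mul_left
        (hnm ▸ hqn)
    exact le_trans (Nat.le_of_dvd (Nat.ordCompl_pos p (by omega)) hq')
      (Nat.le_of_dvd (by have := hp.two_le; omega) hpr)
  have h2 : p ≤ q - 1 := by
    have hnm := (Nat.ordProj_mul_ordCompl_eq_self n q).symm
    have hp' : p ∣ n / q ^ n.factorization q :=
      (Nat.Coprime.pow_right _ ((Nat.coprime_primes hp hq).2 hne)).dvd_of_dvd_mul_left (hnm ▸ hpn)
    exact le_trans (Nat.le_of_dvd (Nat.ordCompl_pos q (by omega)) hp')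
      (Nat.le_of_dvd (by have := hq.two_le; omega) hqr)
  have := hp.two_le
  omega

/-- `(1 + ε)^i = 1 + iε` when `ε² = 0`. [folklore] -/
private theorem one_add_pow_of_sq_zero {R : Type*} [CommRing R] {ε : R} (hε : ε ^ 2 = 0) (i : ℕ) :
    (1 + ε) ^ i = 1 + (i : R) * ε := by
  induction i with
  | zero => simp
  | succ i ih =>
    rw [pow_succ, ih]; push_cast
    linear_combination (i : R) * hε

/-- For an odd prime `p` and `c ≡ 1 (mod p)`: `p² ∤ 1 + c + ⋯ + c^{p−1}` (indeed the sum is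
`≡ p (mod p²)`). [cite: Roitman1997, proof of Prop. 2 ("(1+d)^q − 1)/d = q + Σ binom(q,i) d^{i−1} ≡ q (mod q²)")] -/
theorem not_sq_dvd_geom_sum {p : ℕ} (hp : p.Prime) (hp2 : p ≠ 2) {c : ℤ} (hc : (p : ℤ) ∣ c - 1) :
    ¬ ((p : ℤ) ^ 2 ∣ ∑ i ∈ range p, c ^ i) := by
  intro h
  obtain ⟨t, ht⟩ := hc
  -- in `ZMod (p^2)`: `ε = c - 1` has `ε² = 0` and `ε p = 0`
  have hp0 : ((p : ZMod (p ^ 2))) ^ 2 = 0 := by rw [← Nat.cast_pow, ZMod.natCast_self]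
  set ε : ZMod (p ^ 2) := ((c - 1 : ℤ) : ZMod (p ^ 2)) with hε
  have hε2 : ε ^ 2 = 0 := by rw [hε, ht]; push_cast; rw [mul_pow, hp0, zero_mul]
  have hεp : ε * (p : ZMod (p ^ 2)) = 0 := by
    rw [hε, ht]; push_cast
    linear_combination (t : ZMod (p ^ 2)) * hp0
  have hc' : ((c : ℤ) : ZMod (p ^ 2)) = 1 + ε := by rw [hε]; push_cast; ring
  -- the sum vanishes in `ZMod (p^2)`
  have hsum : ((∑ i ∈ range p, c ^ i : ℤ) : ZMod (p ^ 2)) = 0 := by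
    rw [ZMod.intCast_zmod_eq_zero_iff_dvd]; exact_mod_cast h
  push_cast at hsum
  rw [hc'] at hsum
  simp_rw [one_add_pow_of_sq_zero hε2] at hsum
  rw [sum_add_distrib, sum_const, card_range, ← sum_mul, nsmul_eq_mul, mul_one] at hsum
  -- `2 Σ i = p (p-1)`, hence `0 = 2p + ε p (p-1) = 2p`
  have hS : (∑ i ∈ range p, (i : ZMod (p ^ 2))) * 2 =
      ((p - 1 : ℕ) : ZMod (p ^ 2)) * (p : ZMod (p ^ 2)) := by
    rw [← Nat.cast_sum, show (2 : ZMod (p ^ 2)) = ((2 : ℕ) : ZMod (p ^ 2)) by norm_num,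
      ← Nat.cast_mul, Finset.sum_range_id_mul_two, Nat.cast_mul, mul_comm]
  have h2p : (2 * p : ZMod (p ^ 2)) = 0 := by
    have e1 : ((p : ZMod (p ^ 2)) + (∑ i ∈ range p, (i : ZMod (p ^ 2))) * ε) * 2 = 0 := by
      rw [hsum, zero_mul]
    have e2 : ((p : ZMod (p ^ 2)) + (∑ i ∈ range p, (i : ZMod (p ^ 2))) * ε) * 2 =
        2 * p + ((p - 1 : ℕ) : ZMod (p ^ 2)) * (ε * p) := by
      rw [add_mul, mul_assoc, mul_comm ε 2, ← mul_assoc, hS]; ring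
    rw [e2, hεp, mul_zero, add_zero] at e1
    exact e1
  -- so `p² ∣ 2p`, i.e. `p ∣ 2`
  have hdvd : p ^ 2 ∣ 2 * p := by
    rw [← ZMod.natCast_eq_zero_iff]; exact_mod_cast h2p
  rw [pow_two] at hdvd
  have : p ∣ 2 := Nat.dvd_of_mul_dvd_mul_right hp.pos hdvd
  exact hp2 ((Nat.prime_dvd_prime_iff_eq hp Nat.prime_two).1 this)

/-- **Proposition 2, last part**: if a prime `p ∣ n` divides `Φ_n(a)` (so `p` is a non-Zsigmondy
prime factor), then `p² ∤ Φ_n(a)` — for odd `p` always, for `p = 2` provided `4 ∣ n`.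
[cite: Roitman1997, Prop. 2 ("q² does not divide Φ_n(a) unless q = n = 2")] -/
theorem sq_not_dvd_cyclEval {p n a : ℕ} (hp : p.Prime) (hn : 2 ≤ n) (ha : 2 ≤ a)
    (hd : p ∣ cyclEval n a) (hno : orderOf (a : ZMod p) ≠ n) (h4 : p = 2 → 4 ∣ n) :
    ¬ p ^ 2 ∣ cyclEval n a := by
  haveI := Fact.mk hp
  obtain ⟨hpn, hord, -⟩ := dvd_of_prime_dvd_cyclEval hp hn ha hd hno
  intro h2
  set d := n / p with hdn
  have hdp : d * p = n := Nat.div_mul_cancel hpn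
  have hd1 : 1 ≤ d := by
    rw [hdn]; exact Nat.div_pos (Nat.le_of_dvd (by omega) hpn) hp.pos
  have hdprop : d ∈ n.properDivisors :=
    Nat.mem_properDivisors.2 ⟨Nat.div_dvd_of_dvd hpn, Nat.div_lt_self (by omega) hp.one_lt⟩
  -- `Φ_n(a) ∣ (aⁿ − 1)/(a^d − 1) = Σ_{i<p} (a^d)^i`
  have hmul := pow_sub_one_mul_cyclEval_dvd (by omega : 1 ≤ a) hdprop
  have hgeom : ((a : ℤ) ^ n - 1) = (∑ i ∈ range p, ((a : ℤ) ^ d) ^ i) * ((a : ℤ) ^ d - 1) := by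
    rw [geom_sum_mul, ← pow_mul, hdp]
  have hne : ((a : ℤ) ^ d - 1) ≠ 0 := by
    have : (2 : ℤ) ≤ (a : ℤ) ^ d := by
      exact_mod_cast le_trans ha (Nat.le_self_pow (by omega) a)
    omega
  have hN : (cyclEval n a : ℤ) ∣ ∑ i ∈ range p, ((a : ℤ) ^ d) ^ i := by
    have h' : (((a ^ d - 1) * cyclEval n a : ℕ) : ℤ) ∣ ((a ^ n - 1 : ℕ) : ℤ) :=
      Int.natCast_dvd_natCast.2 hmul
    rw [Nat.cast_sub (Nat.one_le_pow _ _ (by omega)), Nat.cast_mul,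
      Nat.cast_sub (Nat.one_le_pow _ _ (by omega))] at h'
    push_cast at h'
    rw [hgeom, mul_comm] at h'
    exact (mul_dvd_mul_iff_right hne).1 h'
  have hsq : ((p : ℤ) ^ 2) ∣ ∑ i ∈ range p, ((a : ℤ) ^ d) ^ i :=
    dvd_trans (by exact_mod_cast h2) hN
  -- `a^d ≡ 1 (mod p)` because the order `n / p^k` of `a` divides `d = n / p`
  have hk : 1 ≤ n.factorization p := by
    rw [← Nat.Prime.dvd_iff_one_le_factorization hp (by omega)]; exact hpn
  have hrd : n / p ^ n.factorization p ∣ d := by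
    refine ⟨p ^ (n.factorization p - 1), ?_⟩
    have hnm := Nat.ordProj_mul_ordCompl_eq_self n p
    apply Nat.eq_of_mul_eq_mul_right hp.pos
    rw [hdp, mul_assoc, ← pow_succ, Nat.sub_add_cancel hk, mul_comm]
    exact hnm.symm
  have hc : (p : ℤ) ∣ (a : ℤ) ^ d - 1 := by
    have h1 : (a : ZMod p) ^ d = 1 := by
      obtain ⟨e, he⟩ := hrd
      rw [he, pow_mul, ← hord, pow_orderOf_eq_one, one_pow]
    have := (dvd_pow_sub_one_iff (p := p) (by omega : 1 ≤ a)).2 h1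
    have h' := Int.natCast_dvd_natCast.2 this
    rw [Nat.cast_sub (Nat.one_le_pow _ _ (by omega))] at h'
    push_cast at h'
    exact h'
  rcases eq_or_ne p 2 with rfl | hp2
  · -- p = 2, 4 ∣ n: d = n/2 is even, a is odd, so a^d ≡ 1 (mod 4) and 1 + a^d ≡ 2 (mod 4)
    have h4n := h4 rfl
    have hdeven : 2 ∣ d := by
      obtain ⟨e, he⟩ := h4n
      refine ⟨e, ?_⟩
      rw [hdn, he]; omega
    obtain ⟨e, he⟩ := hdeven
    have hodd : Odd (a : ℤ) := by
      have ha0 := cast_ne_zero_of_dvd_cyclEval (p := 2) one_lt_two (by omega) (by omega) hd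
      rcases Int.even_or_odd (a : ℤ) with h | h
      · exfalso; apply ha0
        obtain ⟨k, hk⟩ := h
        have : (a : ZMod 2) = ((a : ℤ) : ZMod 2) := by simp
        rw [this, hk]; push_cast
        rw [← two_mul, show (2 : ZMod 2) = 0 from rfl, zero_mul]
      · exact h
    have hsq4 : ((a : ℤ) ^ e) ^ 2 % 4 = 1 := Int.sq_mod_four_eq_one_of_odd (hodd.pow)
    have hsum : ∑ i ∈ range 2, ((a : ℤ) ^ d) ^ i = 1 + ((a : ℤ) ^ e) ^ 2 := by
      rw [he, sum_range_succ, sum_range_one, pow_zero, pow_one, pow_mul']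
    rw [hsum] at hsq
    norm_num at hsq
    omega
  · exact not_sq_dvd_geom_sum hp hp2 hc hsq

/-! ## Theorem 3 (Zsigmondy's theorem) -/

/-- `p ≤ 2^{p−2}` for `p ≥ 5`. [folklore] -/
private theorem le_two_pow_sub_two {p : ℕ} (hp : 5 ≤ p) : p ≤ 2 ^ (p - 2) := by
  induction p, hp using Nat.le_induction with
  | base => norm_num
  | succ k hk ih =>
    rw [show k + 1 - 2 = (k - 2) + 1 by omega, pow_succ]
    omega

/-- **Zsigmondy's theorem, order form** [Roitman1997, Thm. 3; Zsigmondy1892; Bang 1886]: for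
`a, n ≥ 2`, unless (1) `n = 2` and `a + 1` is a power of `2`, or (2) `(a, n) = (2, 6)`, there is a
prime `p` such that the multiplicative order of `a` modulo `p` is exactly `n` (a Zsigmondy prime).
Proof as printed: all prime factors of `Φ_n(a)` would be non-Zsigmondy, hence equal to the largest
prime factor `q` of `n` (Prop. 2), `Φ_n(a) = q` (or `a + 1 = 2^s` when `n = 2`), and Lemma 1 gives
`b^{q−2}(b−1) < q`, forcing `q = 3`, `b = a = 2`, `n ∈ {3, 6}`, and `n = 3` is excluded by the
Zsigmondy prime `7`. [cite: Roitman1997, Thm. 3] -/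
theorem exists_prime_orderOf_eq {a n : ℕ} (ha : 2 ≤ a) (hn : 2 ≤ n)
    (h1 : n = 2 → ∀ s : ℕ, a + 1 ≠ 2 ^ s) (h2 : ¬ (a = 2 ∧ n = 6)) :
    ∃ p : ℕ, p.Prime ∧ orderOf (a : ZMod p) = n := by
  by_contra H
  have hno : ∀ p : ℕ, p.Prime → orderOf (a : ZMod p) ≠ n := fun p hp h => H ⟨p, hp, h⟩
  have hN2 : 2 ≤ cyclEval n a := two_le_cyclEval hn ha
  obtain ⟨p, hp, hpN⟩ := Nat.exists_prime_and_dvd (show cyclEval n a ≠ 1 by omega)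
  haveI := Fact.mk hp
  obtain ⟨hpn, -, hr⟩ := dvd_of_prime_dvd_cyclEval hp hn ha hpN (hno p hp)
  -- `Φ_n(a)` is a power of `p` (Prop. 2: all its prime factors coincide)
  have hpow : cyclEval n a = p ^ (cyclEval n a).primeFactorsList.length :=
    Nat.eq_prime_pow_of_unique_prime_dvd (by omega) (fun {q} hq hqN =>
      (prime_dvd_cyclEval_unique hp hq hn ha hpN hqN (hno p hp) (hno q hq)).symm)
  set v := (cyclEval n a).primeFactorsList.length with hv
  -- `k = v_p(n) ≥ 1`, `r = n / p^k ∣ p − 1`, `b = a^{p^{k−1}}`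
  set k := n.factorization p with hk
  set r := n / p ^ k with hrdef
  have hk1 : 1 ≤ k := by
    rw [hk, ← Nat.Prime.dvd_iff_one_le_factorization hp (by omega)]; exact hpn
  have hnkr : n = p ^ k * r := (Nat.ordProj_mul_ordCompl_eq_self n p).symm
  have hr0 : 0 < r := Nat.ordCompl_pos p (by omega)
  have hpr : ¬ p ∣ r := Nat.not_dvd_ordCompl hp (by omega)
  have hL := roitman_lemma1 ha hp hk1 hr0 hpr
  rw [← hnkr] at hL
  set b := a ^ p ^ (k - 1) with hb
  have hab : a ≤ b := by rw [hb]; exact Nat.le_self_pow (pow_ne_zero _ hp.ne_zero) a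
  rcases eq_or_ne p 2 with rfl | hp2
  · -- `p = 2`: `r ∣ 1`, so `n = 2^k`
    have hr1 : r = 1 := Nat.dvd_one.1 (by simpa using hr)
    rw [hr1, mul_one] at hnkr
    rcases eq_or_ne k 1 with hk1' | hk1'
    · -- `n = 2`: `Φ₂(a) = a + 1` is a power of `2` — excluded case (1)
      rw [hk1', pow_one] at hnkr
      apply h1 hnkr v
      rw [hv, ← hpow, hnkr, cyclEval_two]
    · -- `n = 2^k`, `k ≥ 2`: `4 ∣ n` so `4 ∤ Φ_n(a)`, i.e. `Φ_n(a) ≤ 2`; but `Φ_n(a) > b − 1 ≥ a − 1 ≥ 2`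
      have h4 : 4 ∣ n := by
        rw [hnkr, show (4 : ℕ) = 2 ^ 2 by norm_num]; exact pow_dvd_pow 2 (by omega)
      have hsq := sq_not_dvd_cyclEval hp hn ha hpN (hno 2 hp) (fun _ => h4)
      have hv1 : v ≤ 1 := by
        by_contra hv2
        apply hsq
        rw [hpow]
        exact pow_dvd_pow 2 (by omega)
      have hle2 : cyclEval n a ≤ 2 := by
        rw [hpow]
        exact le_trans (Nat.pow_le_pow_right two_pos hv1) (by norm_num)
      have ha0 := cast_ne_zero_of_dvd_cyclEval (p := 2) one_lt_two (by omega) (by omega) hpN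
      have ha3 : 3 ≤ a := by
        by_contra h
        apply ha0
        rw [show a = 2 by omega]
        decide
      norm_num at hL
      omega
  · -- `p` odd: `p² ∤ Φ_n(a)`, so `Φ_n(a) = p`
    have hsq := sq_not_dvd_cyclEval hp hn ha hpN (hno p hp) (fun h => absurd h hp2)
    have hv1 : v ≤ 1 := by
      by_contra hv2
      apply hsq
      rw [hpow]
      exact pow_dvd_pow p (by omega)
    have hNp : cyclEval n a = p := by
      have hv0 : v ≠ 0 := by
        intro h0; rw [h0, pow_zero] at hpow; omega
      rw [hpow, show v = 1 by omega, pow_one]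
    rw [hNp] at hL
    -- Lemma 1: `b^{p−2}(b − 1) < p` with `b ≥ 2`; so `p = 3`
    have hp3 : p = 3 := by
      rcases Nat.lt_or_ge p 5 with h5 | h5
      · have := hp.two_le
        interval_cases p
        · exact absurd rfl hp2
        · rfl
        · exact absurd hp (by decide)
      · exfalso
        have h2b : 2 ^ (p - 2) ≤ b ^ (p - 2) := Nat.pow_le_pow_left (by omega) _
        have h3 : b ^ (p - 2) ≤ b ^ (p - 2) * (b - 1) := Nat.le_mul_of_pos_right _ (by omega)
        have h4 := le_two_pow_sub_two h5
        omega
    subst hp3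
    -- `b (b − 1) < 3` gives `b = 2`, hence `a = 2` and `k = 1`
    have hb2 : b = 2 := by
      norm_num at hL
      by_contra hne
      have hb3 : 3 ≤ b := by omega
      have : 3 * 2 ≤ b * (b - 1) := Nat.mul_le_mul hb3 (by omega)
      omega
    have ha2 : a = 2 := by omega
    have hk1' : k = 1 := by
      by_contra hk2
      have h3k : 3 ≤ 3 ^ (k - 1) := by
        calc (3 : ℕ) = 3 ^ 1 := by norm_num
          _ ≤ 3 ^ (k - 1) := Nat.pow_le_pow_right (by norm_num) (by omega)
      have : a ^ 3 ≤ a ^ 3 ^ (k - 1) := Nat.pow_le_pow_right (by omega) h3k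
      rw [← hb, hb2, ha2] at this
      norm_num at this
    rw [hk1', pow_one] at hnkr
    -- `r ∣ 2`: `n = 3` (excluded by the Zsigmondy prime 7) or `n = 6` (case (2))
    have hr2 : r ≤ 2 := Nat.le_of_dvd two_pos (by simpa using hr)
    interval_cases r
    · -- `7` is a Zsigmondy prime for `⟨2, 3⟩`
      apply hno 7 (by norm_num)
      rw [ha2, hnkr]
      exact orderOf_eq_prime (by decide) (by decide)
    · exact h2 ⟨ha2, by omega⟩

/-- **Zsigmondy's theorem** [Roitman1997, Thm. 3], divisibility form as printed: for `a, n ≥ 2`,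
outside the cases (1) `n = 2`, `a = 2^s − 1` and (2) `n = 6`, `a = 2`, there is a prime `q ∣ aⁿ − 1`
with `q ∤ a^j − 1` for all `0 < j < n`. [cite: Roitman1997, Thm. 3; Zsigmondy1892] -/
theorem zsigmondy {a n : ℕ} (ha : 2 ≤ a) (hn : 2 ≤ n)
    (h1 : n = 2 → ∀ s : ℕ, a + 1 ≠ 2 ^ s) (h2 : ¬ (a = 2 ∧ n = 6)) :
    ∃ q : ℕ, q.Prime ∧ q ∣ a ^ n - 1 ∧ ∀ j : ℕ, 0 < j → j < n → ¬ q ∣ a ^ j - 1 := by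
  obtain ⟨q, hq, hord⟩ := exists_prime_orderOf_eq ha hn h1 h2
  refine ⟨q, hq, ?_, fun j hj hjn hdvd => ?_⟩
  · rw [dvd_pow_sub_one_iff (by omega : 1 ≤ a), ← hord]; exact pow_orderOf_eq_one _
  · rw [dvd_pow_sub_one_iff (by omega : 1 ≤ a)] at hdvd
    have := orderOf_dvd_of_pow_eq_one hdvd
    rw [hord] at this
    exact absurd (Nat.le_of_dvd hj this) (by omega)

/-- Exceptional case (2) is genuine: `2⁶ − 1 = 63 = 3²·7`, and `3 ∣ 2² − 1`, `7 ∣ 2³ − 1`.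
[cite: Roitman1997, Thm. 3 (case (2))] -/
theorem no_zsigmondy_prime_two_six :
    ¬ ∃ q : ℕ, q.Prime ∧ q ∣ 2 ^ 6 - 1 ∧ ∀ j : ℕ, 0 < j → j < 6 → ¬ q ∣ 2 ^ j - 1 := by
  rintro ⟨q, hq, hd, hj⟩
  have h63 : q ∣ 9 * 7 := by norm_num at hd; simpa using hd
  rcases (Nat.Prime.dvd_mul hq).1 h63 with h9 | h7
  · have h3 : q = 3 := (Nat.prime_dvd_prime_iff_eq hq Nat.prime_three).1
      (hq.dvd_of_dvd_pow (show q ∣ 3 ^ 2 by simpa using h9))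
    exact hj 2 (by norm_num) (by norm_num) (by rw [h3]; norm_num)
  · have h7' : q = 7 := (Nat.prime_dvd_prime_iff_eq hq (by norm_num)).1 h7
    exact hj 3 (by norm_num) (by norm_num) (by rw [h7']; norm_num)

/-- Exceptional case (1) is genuine: if `a + 1 = 2^s` then every prime factor of `a² − 1 = (a−1)(a+1)`
already divides `a − 1`. [cite: Roitman1997, Thm. 3 (case (1))] -/
theorem no_zsigmondy_prime_mersenne {a s : ℕ} (ha : 2 ≤ a) (hs : a + 1 = 2 ^ s) :
    ¬ ∃ q : ℕ, q.Prime ∧ q ∣ a ^ 2 - 1 ∧ ∀ j : ℕ, 0 < j → j < 2 → ¬ q ∣ a ^ j - 1 := by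
  rintro ⟨q, hq, hd, hj⟩
  have hj1 := hj 1 one_pos one_lt_two
  rw [pow_one] at hj1
  have hfac : a ^ 2 - 1 = (a - 1) * (a + 1) := by
    have : 1 ≤ a := by omega
    zify [this, Nat.one_le_pow 2 a this]; ring
  rw [hfac] at hd
  rcases (Nat.Prime.dvd_mul hq).1 hd with h | h
  · exact hj1 h
  · rw [hs] at h
    have hq2 : q = 2 := (Nat.prime_dvd_prime_iff_eq hq Nat.prime_two).1 (hq.dvd_of_dvd_pow h)
    apply hj1
    rw [hq2]
    -- `a = 2^s − 1` is odd (`s ≥ 1`), so `2 ∣ a − 1`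
    have hs1 : 1 ≤ s := by
      by_contra h0
      rw [show s = 0 by omega, pow_zero] at hs; omega
    obtain ⟨t, ht⟩ : ∃ t, s = t + 1 := ⟨s - 1, by omega⟩
    rw [ht, pow_succ] at hs
    exact ⟨2 ^ t - 1, by have := Nat.one_le_two_pow (n := t); omega⟩

/-! ## Corollaries (lit g12, second pass) -/

/-- A Zsigmondy prime `p` for `⟨a, n⟩` (`ord_p(a) = n ≥ 1`) satisfies `n ∣ p − 1`, hence `p ≥ n + 1`.
[cite: Roitman1997, §1 ("If p is a Zsigmondy prime for ⟨a, n⟩, then n | p − 1; thus p ≥ n + 1")] -/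
theorem dvd_sub_one_of_orderOf_eq {p a n : ℕ} (hp : p.Prime) (hn : 1 ≤ n)
    (h : orderOf (a : ZMod p) = n) : n ∣ p - 1 ∧ n + 1 ≤ p := by
  haveI := Fact.mk hp
  have ha : (a : ZMod p) ≠ 0 := by
    intro h0
    rw [h0, orderOf_eq_zero_iff'.2 (fun k hk hk0 => by
      rw [zero_pow (by omega)] at hk0; exact zero_ne_one hk0)] at h
    omega
  have hd : n ∣ p - 1 := h ▸ ZMod.orderOf_dvd_card_sub_one ha
  refine ⟨hd, ?_⟩
  have := Nat.le_of_dvd (by have := hp.two_le; omega) hd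
  have := hp.two_le
  omega

/-- Zsigmondy for `n ≥ 3`: the only exception is `(a, n) = (2, 6)`.
[cite: Roitman1997, Thm. 3] -/
theorem exists_prime_orderOf_eq_of_three_le {a n : ℕ} (ha : 2 ≤ a) (hn : 3 ≤ n)
    (h : ¬ (a = 2 ∧ n = 6)) : ∃ p : ℕ, p.Prime ∧ orderOf (a : ZMod p) = n :=
  exists_prime_orderOf_eq ha (by omega) (fun h2 => absurd h2 (by omega)) h

/-- In particular, for `n ≥ 3`, `(a, n) ≠ (2, 6)`, some prime `p ≡ 1 (mod n)` divides `aⁿ − 1` but no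
`a^j − 1`, `0 < j < n`. [cite: Roitman1997, Thm. 3 + §1 remark] -/
theorem exists_prime_modEq_one_dvd_pow_sub_one {a n : ℕ} (ha : 2 ≤ a) (hn : 3 ≤ n)
    (h : ¬ (a = 2 ∧ n = 6)) :
    ∃ p : ℕ, p.Prime ∧ p ≡ 1 [MOD n] ∧ p ∣ a ^ n - 1 ∧ ∀ j : ℕ, 0 < j → j < n → ¬ p ∣ a ^ j - 1 := by
  obtain ⟨p, hp, hord⟩ := exists_prime_orderOf_eq_of_three_le ha hn h
  obtain ⟨hd, hle⟩ := dvd_sub_one_of_orderOf_eq hp (by omega) hord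
  refine ⟨p, hp, ((Nat.modEq_iff_dvd' (by omega)).2 hd).symm, ?_, fun j hj hjn hdvd => ?_⟩
  · rw [dvd_pow_sub_one_iff (by omega : 1 ≤ a), ← hord]; exact pow_orderOf_eq_one _
  · rw [dvd_pow_sub_one_iff (by omega : 1 ≤ a)] at hdvd
    have := orderOf_dvd_of_pow_eq_one hdvd
    rw [hord] at this
    exact absurd (Nat.le_of_dvd hj this) (by omega)

/-- **Bang's theorem** (1886), the case `a = 2`: for every `n ≥ 2`, `n ≠ 6`, the Mersenne number
`2ⁿ − 1` has a primitive prime divisor (a prime `p` with `ord_p(2) = n`).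
[cite: Roitman1997, Thm. 3 (a = 2; Bang 1886)] -/
theorem bang_two {n : ℕ} (hn : 2 ≤ n) (h6 : n ≠ 6) :
    ∃ p : ℕ, p.Prime ∧ orderOf (2 : ZMod p) = n := by
  have := exists_prime_orderOf_eq (a := 2) (n := n) le_rfl hn
    (fun _ s hs => by
      -- `2 + 1 = 3` is not a power of `2`
      have h3 : (2 : ℕ) ^ s = 3 := by omega
      rcases s with _ | _ | s
      · norm_num at h3
      · norm_num at h3
      · have : 4 ≤ 2 ^ (s + 2) := by
          calc (4 : ℕ) = 2 ^ 2 := by norm_num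
            _ ≤ 2 ^ (s + 2) := Nat.pow_le_pow_right two_pos (by omega)
        omega)
    (fun h => h6 h.2)
  simpa using this

end Literature.NumberTheory.Congruences.Zsigmondy
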